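import Summits.QuantumAdvantage.QuantumAdvantage.Theorems.CharDialPlaneDivAscentA
import HarnessLib

/-!
# PlaneDivAscent — plane-divisible point sets over `𝔽_p`: the period codimension is decided in a finite
band of dimensions (PART B)
(cell decomp-qadv, lens 6 «barrier-complement carving», g21; tree-ready, Prop-definition-free; Part A =
`Theorems.CharDialPlaneDivAscentA`)

The law «every plane-divisible `S ⊆ W` satisfies `finrank W ≤ finrank (perIn W S) + K`» (`S` is a cylinder
over `≤ K` linear forms; the finite-field core of the second structure law of the CharDial degree ladder is
the case `K = K_field(p)`, conjecturally `3`) quantifies over every dimension.  This part proves that the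
dimensions above `(p-1)·K + 1` take care of themselves:

* `finrank_le_finrank_inf_add` — codimension counting: subspaces of codimension `≤ K` in `W₀`, indexed by a
  finset `s`, meet `W₀` in codimension `≤ |s|·K`;
* `planeCount_eq_sum`, `dvd_lineCount_of_period`, ★ `period_slice_of_others` — ALL-BUT-ONE: a vector that
  is a period of every slice of `S` along `d₀` except possibly one is a period of that slice too (the
  vertical planes `y + ⟨d, d₀⟩` have `≡ 0 (mod p)` points, the other slices contribute multiples of `p`,
  so the last line count is `0` or `p`);
* ★ `exists_period_of_large` — if `dim W ≥ (p-1)·K + 2` and the law holds below `dim W`, a plane-divisible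
  `S ⊆ W` has a nonzero period (the period spaces of the `p - 1` slices `t ≠ 0` meet non-trivially; the
  common vector is a period of the `0`-slice by all-but-one, hence of `S` by `period_of_slices`);
* ★ `finrank_le_of_band` — ENGINE: the law in the band `K < dim W ≤ (p-1)·K + 1` (each dimension granted
  the law below it) implies the law in every dimension (strong induction on `finrank W`, DESCENT
  `finrank_le_of_period` from Part A);
* ★ `law_iff_band` — HEADLINE: for fixed `p, n, K` the law for all subspaces `W ≤ 𝔽_pⁿ` is equivalent to
  the law for the subspaces of dimension `≤ (p-1)·K + 1`.  (At `p = 5`, `K = 3`: dimensions `≤ 13`.)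
-/

set_option autoImplicit false

namespace Summit.QuantumAdvantage.AdviceFreeQNC0.PlaneDiv

open Finset Module

variable {p : ℕ} [Fact p.Prime] {n : ℕ}

/-! ## (6) codimension counting -/

/-- Codimension counting: subspaces `P t ≤ W₀` (`t ∈ s`), each of codimension `≤ K` in `W₀`, meet `W₀`
in a subspace of codimension `≤ |s|·K`. -/
theorem finrank_le_finrank_inf_add {W₀ : Submodule (ZMod p) (Fin n → ZMod p)}
    (P : ZMod p → Submodule (ZMod p) (Fin n → ZMod p)) (K : ℕ) (hP : ∀ t, P t ≤ W₀)
    (hK : ∀ t, finrank (ZMod p) W₀ ≤ finrank (ZMod p) (P t) + K) (s : Finset (ZMod p)) :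
    finrank (ZMod p) W₀ ≤ finrank (ZMod p) ↥(W₀ ⊓ s.inf P) + s.card * K := by
  induction s using Finset.induction_on with
  | empty => rw [Finset.inf_empty, inf_top_eq]; simp
  | @insert t s hts ih =>
    rw [Finset.inf_insert, Finset.card_insert_of_notMem hts]
    have key := Submodule.finrank_sup_add_finrank_inf_eq (W₀ ⊓ s.inf P) (P t)
    have hsup : finrank (ZMod p) ↥((W₀ ⊓ s.inf P) ⊔ P t) ≤ finrank (ZMod p) W₀ :=
      Submodule.finrank_mono (sup_le inf_le_left (hP t))
    have heq : W₀ ⊓ (P t ⊓ s.inf P) = (W₀ ⊓ s.inf P) ⊓ P t := by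
      rw [inf_assoc, inf_comm (P t)]
    rw [heq]
    have := hK t
    nlinarith [key, hsup, this, ih]

/-! ## (7) all-but-one -/

/-- The parametrised plane count, fibred over the second parameter. -/
theorem planeCount_eq_sum (S : Finset (Fin n → ZMod p)) (y d d₀ : Fin n → ZMod p) :
    planeCount S y d d₀ =
      ∑ t : ZMod p, (Finset.univ.filter fun s : ZMod p => y + s • d + t • d₀ ∈ S).card := by
  unfold planeCount
  simp only [Finset.card_filter]
  rw [Fintype.sum_prod_type, Finset.sum_comm]

/-- Line counts along a period are `0` or `p`, hence divisible by `p`. -/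
theorem dvd_lineCount_of_period {T : Finset (Fin n → ZMod p)} {d : Fin n → ZMod p}
    (hT : ∀ x, x ∈ T ↔ x + d ∈ T) (y : Fin n → ZMod p) :
    p ∣ (Finset.univ.filter fun s : ZMod p => y + s • d ∈ T).card := by
  by_cases hy : y ∈ T
  · have h : (Finset.univ.filter fun s : ZMod p => y + s • d ∈ T) = Finset.univ :=
      Finset.filter_true_of_mem fun s _ => ((period_smul hT s) y).mp hy
    rw [h, Finset.card_univ, ZMod.card]
  · have h : (Finset.univ.filter fun s : ZMod p => y + s • d ∈ T) = ∅ :=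
      Finset.filter_false_of_mem fun s _ hs => hy (((period_smul hT s) y).mpr hs)
    rw [h, Finset.card_empty]
    exact dvd_zero p

/-- ALL-BUT-ONE.  If `d ∈ W₀` is a period of every slice of the plane-divisible `S ⊆ W` along `d₀ ∈ W`
except possibly the `t₀`-slice, then it is a period of the `t₀`-slice as well. -/
theorem period_slice_of_others {W W₀ : Submodule (ZMod p) (Fin n → ZMod p)}
    {S : Finset (Fin n → ZMod p)} {d₀ d : Fin n → ZMod p}
    (hdiv : ∀ x ∈ W, ∀ a ∈ W, ∀ b ∈ W, p ∣ planeCount S x a b) (hW₀ : W₀ ≤ W)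
    (hd₀ : d₀ ∈ W) (hd : d ∈ W₀) (t₀ : ZMod p)
    (hper : ∀ t : ZMod p, t ≠ t₀ → ∀ y, y ∈ slice W₀ S d₀ t ↔ y + d ∈ slice W₀ S d₀ t) :
    ∀ y, y ∈ slice W₀ S d₀ t₀ ↔ y + d ∈ slice W₀ S d₀ t₀ := by
  intro y
  by_cases hy : y ∈ W₀
  swap
  · have h1 : y ∉ slice W₀ S d₀ t₀ := fun h => hy (mem_slice.mp h).1
    have h2 : y + d ∉ slice W₀ S d₀ t₀ := by
      intro h
      have := W₀.sub_mem (mem_slice.mp h).1 hd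
      simp at this
      exact hy this
    simp [h1, h2]
  -- line counts of `y + ⟨d⟩` in the slices
  set c : ZMod p → ℕ := fun t =>
    (Finset.univ.filter fun s : ZMod p => y + s • d ∈ slice W₀ S d₀ t).card with hc
  have heq : ∀ t : ZMod p,
      (Finset.univ.filter fun s : ZMod p => y + s • d + t • d₀ ∈ S).card = c t := by
    intro t
    simp only [hc]
    congr 1
    apply Finset.filter_congr
    intro s _
    rw [mem_slice]
    simp [W₀.add_mem hy (W₀.smul_mem s hd)]
  have hsum : p ∣ ∑ t, c t := by
    have h := hdiv y (hW₀ hy) d (hW₀ hd) d₀ hd₀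
    rw [planeCount_eq_sum] at h
    simpa only [heq] using h
  have hothers : ∀ t, t ≠ t₀ → p ∣ c t := fun t ht => dvd_lineCount_of_period (hper t ht) y
  have hc₀ : p ∣ c t₀ := by
    rw [← Finset.add_sum_erase _ _ (Finset.mem_univ t₀)] at hsum
    have h2 : p ∣ ∑ t ∈ Finset.univ.erase t₀, c t :=
      Finset.dvd_sum fun t ht => hothers t (Finset.ne_of_mem_erase ht)
    exact (Nat.dvd_add_iff_left h2).mpr hsum
  have hle : c t₀ ≤ p := by
    calc c t₀ ≤ (Finset.univ : Finset (ZMod p)).card := Finset.card_filter_le _ _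
      _ = p := by rw [Finset.card_univ, ZMod.card]
  -- hence the line count in the `t₀`-slice is `0` or `p`
  by_cases hzero : c t₀ = 0
  · have hempty : (Finset.univ.filter fun s : ZMod p => y + s • d ∈ slice W₀ S d₀ t₀) = ∅ :=
      Finset.card_eq_zero.mp hzero
    have hnot : ∀ s : ZMod p, y + s • d ∉ slice W₀ S d₀ t₀ := by
      intro s hs
      have : s ∈ (Finset.univ.filter fun s : ZMod p => y + s • d ∈ slice W₀ S d₀ t₀) :=
        Finset.mem_filter.mpr ⟨Finset.mem_univ s, hs⟩
      rw [hempty] at this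
      simp at this
    have h1 := hnot 0
    have h2 := hnot 1
    simp only [zero_smul, add_zero] at h1
    simp only [one_smul] at h2
    simp [h1, h2]
  · have hcp : c t₀ = p := by
      have := Nat.le_of_dvd (Nat.pos_of_ne_zero hzero) hc₀
      omega
    have huniv : (Finset.univ.filter fun s : ZMod p => y + s • d ∈ slice W₀ S d₀ t₀) =
        Finset.univ :=
      Finset.eq_univ_of_card _ (by rw [ZMod.card]; exact hcp)
    have hall : ∀ s : ZMod p, y + s • d ∈ slice W₀ S d₀ t₀ := by
      intro s
      have : s ∈ (Finset.univ.filter fun s : ZMod p => y + s • d ∈ slice W₀ S d₀ t₀) := by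
        rw [huniv]; exact Finset.mem_univ s
      exact (Finset.mem_filter.mp this).2
    have h1 := hall 0
    have h2 := hall 1
    simp only [zero_smul, add_zero] at h1
    simp only [one_smul] at h2
    simp [h1, h2]

/-! ## (8) large dimensions force a period -/

/-- SHARP COUNTING ASCENT.  If `S ⊆ W` is plane-divisible, `dim W ≥ (p-1)·K + 2`, and the codimension
bound `K` holds for plane-divisible sets in all subspaces of smaller dimension, then `S` has a nonzero
period in `W`. -/
theorem exists_period_of_large {W : Submodule (ZMod p) (Fin n → ZMod p)}
    {S : Finset (Fin n → ZMod p)} {K : ℕ} (hSW : ∀ x ∈ S, x ∈ W)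
    (hdiv : ∀ x ∈ W, ∀ a ∈ W, ∀ b ∈ W, p ∣ planeCount S x a b)
    (hdim : (p - 1) * K + 2 ≤ finrank (ZMod p) W)
    (ih : ∀ (W' : Submodule (ZMod p) (Fin n → ZMod p)) (S' : Finset (Fin n → ZMod p)),
      finrank (ZMod p) W' < finrank (ZMod p) W → (∀ x ∈ S', x ∈ W') →
      (∀ x ∈ W', ∀ a ∈ W', ∀ b ∈ W', p ∣ planeCount S' x a b) →
      finrank (ZMod p) W' ≤ finrank (ZMod p) (perIn W' S') + K) :
    ∃ d ∈ perIn W S, d ≠ 0 := by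
  have hW : (1 : ℕ) ≤ finrank (ZMod p) W := by omega
  obtain ⟨d₀, hd₀W, hd₀⟩ :=
    Submodule.exists_mem_ne_zero_of_ne_bot (Submodule.one_le_finrank_iff.mp hW)
  obtain ⟨W₀, hW₀W, _hbot, hdec, hrank⟩ := exists_hyperplane hd₀W hd₀
  set P : ZMod p → Submodule (ZMod p) (Fin n → ZMod p) := fun t => perIn W₀ (slice W₀ S d₀ t)
    with hPdef
  have hP : ∀ t, P t ≤ W₀ := fun t => perIn_le _ _
  have hK : ∀ t, finrank (ZMod p) W₀ ≤ finrank (ZMod p) (P t) + K := fun t =>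
    ih W₀ _ (by omega) (slice_subset W₀ S d₀ t) (dvd_planeCount_slice hdiv hW₀W hd₀W t)
  have hcount := finrank_le_finrank_inf_add P K hP hK (Finset.univ.erase 0)
  rw [Finset.card_erase_of_mem (Finset.mem_univ _), Finset.card_univ, ZMod.card] at hcount
  have h1 : (1 : ℕ) ≤ finrank (ZMod p) ↥(W₀ ⊓ (Finset.univ.erase (0 : ZMod p)).inf P) := by
    omega
  obtain ⟨z, hz, hz0⟩ :=
    Submodule.exists_mem_ne_zero_of_ne_bot (Submodule.one_le_finrank_iff.mp h1)
  have hzW₀ : z ∈ W₀ := hz.1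
  have hzP : ∀ t : ZMod p, t ≠ 0 → z ∈ P t := fun t ht =>
    (Submodule.mem_finsetInf.mp hz.2) t (Finset.mem_erase.mpr ⟨ht, Finset.mem_univ t⟩)
  have hz0slice : ∀ y, y ∈ slice W₀ S d₀ 0 ↔ y + z ∈ slice W₀ S d₀ 0 :=
    period_slice_of_others hdiv hW₀W hd₀W hzW₀ 0 fun t ht => (hzP t ht).2
  refine ⟨z, ⟨hW₀W hzW₀, ?_⟩, hz0⟩
  refine period_of_slices hSW hW₀W hdec hzW₀ fun t => ?_
  by_cases ht : t = 0
  · rw [ht]; exact hz0slice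
  · exact (hzP t ht).2

/-! ## (9) the engine and the headline reduction -/

/-- ENGINE.  Fix `p, n, K`.  If in every dimension `m` with `K < m ≤ (p-1)·K + 1` a plane-divisible set
has a nonzero period (granted the codimension bound in all smaller dimensions), then every plane-divisible
set in every subspace satisfies the codimension bound `K`: dimensions `≤ K` are trivial, dimensions
`≥ (p-1)·K + 2` are `exists_period_of_large`, and a period descends by `finrank_le_of_period`. -/
theorem finrank_le_of_band (K : ℕ)
    (band : ∀ (W : Submodule (ZMod p) (Fin n → ZMod p)) (S : Finset (Fin n → ZMod p)),
      K < finrank (ZMod p) W → finrank (ZMod p) W ≤ (p - 1) * K + 1 → (∀ x ∈ S, x ∈ W) →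
      (∀ x ∈ W, ∀ a ∈ W, ∀ b ∈ W, p ∣ planeCount S x a b) →
      (∀ (W' : Submodule (ZMod p) (Fin n → ZMod p)) (S' : Finset (Fin n → ZMod p)),
        finrank (ZMod p) W' < finrank (ZMod p) W → (∀ x ∈ S', x ∈ W') →
        (∀ x ∈ W', ∀ a ∈ W', ∀ b ∈ W', p ∣ planeCount S' x a b) →
        finrank (ZMod p) W' ≤ finrank (ZMod p) (perIn W' S') + K) →
      ∃ d ∈ perIn W S, d ≠ 0)
    (W : Submodule (ZMod p) (Fin n → ZMod p)) (S : Finset (Fin n → ZMod p))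
    (hSW : ∀ x ∈ S, x ∈ W) (hdiv : ∀ x ∈ W, ∀ a ∈ W, ∀ b ∈ W, p ∣ planeCount S x a b) :
    finrank (ZMod p) W ≤ finrank (ZMod p) (perIn W S) + K := by
  suffices h : ∀ (m : ℕ) (W : Submodule (ZMod p) (Fin n → ZMod p)) (S : Finset (Fin n → ZMod p)),
      finrank (ZMod p) W = m → (∀ x ∈ S, x ∈ W) →
      (∀ x ∈ W, ∀ a ∈ W, ∀ b ∈ W, p ∣ planeCount S x a b) →
      finrank (ZMod p) W ≤ finrank (ZMod p) (perIn W S) + K from h _ W S rfl hSW hdiv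
  intro m
  induction m using Nat.strong_induction_on with
  | _ m ihm =>
    intro W S hm hSW hdiv
    have ih : ∀ (W' : Submodule (ZMod p) (Fin n → ZMod p)) (S' : Finset (Fin n → ZMod p)),
        finrank (ZMod p) W' < finrank (ZMod p) W → (∀ x ∈ S', x ∈ W') →
        (∀ x ∈ W', ∀ a ∈ W', ∀ b ∈ W', p ∣ planeCount S' x a b) →
        finrank (ZMod p) W' ≤ finrank (ZMod p) (perIn W' S') + K :=
      fun W' S' hlt hSW' hdiv' => ihm _ (hm ▸ hlt) W' S' rfl hSW' hdiv'
    by_cases hle : finrank (ZMod p) W ≤ K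
    · exact le_trans hle (Nat.le_add_left _ _)
    obtain ⟨d, hd, hd0⟩ : ∃ d ∈ perIn W S, d ≠ 0 := by
      by_cases hband : finrank (ZMod p) W ≤ (p - 1) * K + 1
      · exact band W S (by omega) hband hSW hdiv ih
      · exact exists_period_of_large hSW hdiv (by omega) ih
    exact finrank_le_of_period hSW hdiv hd hd0 ih

/-- HEADLINE REDUCTION (one `p`, one ambient dimension `n`, one `K`): the codimension bound for ALL
subspaces is equivalent to the bound for the subspaces of dimension `≤ (p-1)·K + 1`. -/
theorem law_iff_band (K : ℕ) :
    (∀ (W : Submodule (ZMod p) (Fin n → ZMod p)) (S : Finset (Fin n → ZMod p)),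
        (∀ x ∈ S, x ∈ W) → (∀ x ∈ W, ∀ a ∈ W, ∀ b ∈ W, p ∣ planeCount S x a b) →
        finrank (ZMod p) W ≤ finrank (ZMod p) (perIn W S) + K) ↔
    (∀ (W : Submodule (ZMod p) (Fin n → ZMod p)) (S : Finset (Fin n → ZMod p)),
        finrank (ZMod p) W ≤ (p - 1) * K + 1 → (∀ x ∈ S, x ∈ W) →
        (∀ x ∈ W, ∀ a ∈ W, ∀ b ∈ W, p ∣ planeCount S x a b) →
        finrank (ZMod p) W ≤ finrank (ZMod p) (perIn W S) + K) := by
  constructor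
  · exact fun h W S _ hSW hdiv => h W S hSW hdiv
  · intro h W S hSW hdiv
    refine finrank_le_of_band K (fun W S hK hsmall hSW hdiv _ => ?_) W S hSW hdiv
    exact exists_period_of_finrank_le (h W S hsmall hSW hdiv) hK

/-- The law at ambient level: if the codimension bound `K` holds for every subspace of `𝔽_pⁿ` of dimension
`≤ (p-1)·K + 1`, then every plane-divisible `S ⊆ 𝔽_pⁿ` (all parametrised planes of the whole space) has
period space of dimension `≥ n - K`. -/
theorem finrank_perIn_top_ge (K : ℕ)
    (h : ∀ (W : Submodule (ZMod p) (Fin n → ZMod p)) (S : Finset (Fin n → ZMod p)),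
        finrank (ZMod p) W ≤ (p - 1) * K + 1 → (∀ x ∈ S, x ∈ W) →
        (∀ x ∈ W, ∀ a ∈ W, ∀ b ∈ W, p ∣ planeCount S x a b) →
        finrank (ZMod p) W ≤ finrank (ZMod p) (perIn W S) + K)
    (S : Finset (Fin n → ZMod p)) (hdiv : ∀ x a b : Fin n → ZMod p, p ∣ planeCount S x a b) :
    n ≤ finrank (ZMod p) (perIn ⊤ S) + K := by
  have := (law_iff_band K).mpr h ⊤ S (fun _ _ => Submodule.mem_top)
    (fun x _ a _ b _ => hdiv x a b)
  simpa using this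

end Summit.QuantumAdvantage.AdviceFreeQNC0.PlaneDiv
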